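import Summits.NavierStokesRegularity.FunctionalMining.StretchingLaminateField
import Summits.NavierStokesRegularity.FunctionalMining.StretchingLaminateBounds
import HarnessLib

/-!
# K1-Q1 laminate step, part 6: POINTWISE structure of `G + ∇curl A` — the ceiling and the plateau expansions

Cell `pub-nsfunc` (host summit NavierStokesRegularity, topic `FunctionalMining`), prove seat gen 6, for the
`LaminateStep` node (dict BLUEPRINT §2, §3 Steps 1–2). **Search for candidate a priori estimates; no regularity
claim.** Static smooth fields on `T³`.

With `T(x) = G + ∇curl A(x)` (`A = Atot m`) and the main term
`Z(x) = G + φ(k·x)M + E₊(x)X₊(m•x) + E₋(x)X₋(m•x)`: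
* `abs_T_sub_Z_le`: `|T − Z| ≤ ρ₊ + ρ₋` entrywise (tree remainder bound for each confined child);
* **`vortSqM_T_le`** (the CEILING): `|ω(T(x))|² ≤ max B₊ B₋ + 24ρ′(β′+ρ′)` from `Laminate.ceiling_core`;
* `prodBC_Z_eq`, `halfSqM_Z_eq`: the plateau expansions of the densities of `Z` (constant bases `Y± `);
* smoothness / continuity bookkeeping of the densities along `∇curl A±` (for the two-scale lemma).
-/

noncomputable section

open MeasureTheory Set Filter Topology Function
open scoped ContDiff

namespace Summit.NavierStokesRegularity.FunctionalMining

open Literature.Analysis Literature.Analysis.FunctionSpaces Literature.Analysis.FunctionSpaces.Torus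
open Literature.Analysis.FluidPDE Literature.Analysis.FluidPDE.Torus
open LaminateWindow LaminateDirection WrapStretching Confinement Laminate

/-! ## 1. Smoothness and continuity of matrix densities along smooth matrix fields -/

section Densities

variable {A B C : UnitAddTorus (Fin 3) → Fin 3 → Fin 3 → ℝ}

/-- `x ↦ triBC (A x) (B x) (C x)` is smooth when all entries are. [folklore] -/
theorem isSmooth_triBC (hA : ∀ i j, IsSmooth fun x => A x i j) (hB : ∀ i j, IsSmooth fun x => B x i j)
    (hC : ∀ i j, IsSmooth fun x => C x i j) : IsSmooth fun x => triBC (A x) (B x) (C x) := by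
  unfold triBC
  refine isSmooth_sub' (Confinement.isSmooth_finset_sum _ fun i _ => Confinement.isSmooth_finset_sum _ fun j _ => Confinement.isSmooth_finset_sum _
    fun k _ => isSmooth_mul' (isSmooth_mul' (hA i j) (hB j k)) (hC k i)) (Confinement.isSmooth_finset_sum _ fun m _ =>
    Confinement.isSmooth_finset_sum _ fun i _ => isSmooth_mul' (hA i m) (Confinement.isSmooth_finset_sum _ fun j _ => isSmooth_mul' (hB j m) (hC j i)))

end Densities

section Continuity

variable {α : Type*} [TopologicalSpace α] {A B C : α → Fin 3 → Fin 3 → ℝ}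

/-- `x ↦ triBC (A x) (B x) (C x)` is continuous when all entries are. [folklore] -/
theorem continuous_triBC (hA : ∀ i j, Continuous fun x => A x i j) (hB : ∀ i j, Continuous fun x => B x i j)
    (hC : ∀ i j, Continuous fun x => C x i j) : Continuous fun x => triBC (A x) (B x) (C x) := by
  unfold triBC; fun_prop

/-- `x ↦ prodBC (A x)` is continuous when all entries are. [folklore] -/
theorem continuous_prodBC' (hA : ∀ i j, Continuous fun x => A x i j) : Continuous fun x => prodBC (A x) := by
  simp only [prodBC_eq_triBC]; exact continuous_triBC hA hA hA

/-- `x ↦ halfSqM (A x)` is continuous when all entries are. [folklore] -/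
theorem continuous_halfSqM (hA : ∀ i j, Continuous fun x => A x i j) : Continuous fun x => halfSqM (A x) := by
  unfold halfSqM; fun_prop

/-- `x ↦ frob (A x) (B x)` is continuous when all entries are. [folklore] -/
theorem continuous_frob (hA : ∀ i j, Continuous fun x => A x i j) (hB : ∀ i j, Continuous fun x => B x i j) :
    Continuous fun x => frob (A x) (B x) := by
  unfold frob; fun_prop

/-- `x ↦ vortSqM (A x)` is continuous when all entries are. [folklore] -/
theorem continuous_vortSqM (hA : ∀ i j, Continuous fun x => A x i j) : Continuous fun x => vortSqM (A x) := by
  unfold vortSqM; fun_prop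

end Continuity

section AlongGrad

variable {v : UnitAddTorus (Fin 3) → EuclideanSpace ℝ (Fin 3)} (hv : IsSmooth v) (Y : Fin 3 → Fin 3 → ℝ)
include hv

/-- `y ↦ mix₁ Y (∇v(y))` is smooth. [folklore] -/
theorem isSmooth_mix₁_gradAt : IsSmooth fun y => mix₁ Y (gradAt v y) := by
  have hg := isSmooth_gradAt hv
  have hc : ∀ i j, IsSmooth fun _ : UnitAddTorus (Fin 3) => Y i j := fun i j => isSmooth_const _
  unfold mix₁
  exact ((isSmooth_triBC hc hc hg).add (isSmooth_triBC hc hg hc)).add (isSmooth_triBC hg hc hc)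

/-- `y ↦ mix₂ Y (∇v(y))` is smooth. [folklore] -/
theorem isSmooth_mix₂_gradAt : IsSmooth fun y => mix₂ Y (gradAt v y) := by
  have hg := isSmooth_gradAt hv
  have hc : ∀ i j, IsSmooth fun _ : UnitAddTorus (Fin 3) => Y i j := fun i j => isSmooth_const _
  unfold mix₂
  exact ((isSmooth_triBC hc hg hg).add (isSmooth_triBC hg hc hg)).add (isSmooth_triBC hg hg hc)

/-- `y ↦ frob Y (∇v(y))` is smooth. [folklore] -/
theorem isSmooth_frob_gradAt : IsSmooth fun y => frob Y (gradAt v y) := by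
  have hg := isSmooth_gradAt hv
  unfold frob
  exact Confinement.isSmooth_finset_sum _ fun i _ => Confinement.isSmooth_finset_sum _ fun j _ => isSmooth_mul' (isSmooth_const _) (hg i j)

/-- `y ↦ halfSqM (∇v(y))` is smooth. [folklore] -/
theorem isSmooth_halfSqM_gradAt : IsSmooth fun y => halfSqM (gradAt v y) := by
  have hg := isSmooth_gradAt hv
  have e : (fun y => halfSqM (gradAt v y)) = fun y => (1 / 2 : ℝ) * ∑ i, ∑ j, gradAt v y i j ^ 2 := by
    funext y; simp only [halfSqM]; ring
  rw [e]
  exact isSmooth_mul' (isSmooth_const _) (Confinement.isSmooth_finset_sum _ fun i _ => Confinement.isSmooth_finset_sum _ fun j _ =>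
    isSmooth_pow' (hg i j) 2)

end AlongGrad

namespace LamData

variable (D : LamData)

/-! ## 2. The main term `Z` and the remainder -/

/-- The main term `Z(x) = G + φ(k·x)M + E₊(x)X₊(m•x) + E₋(x)X₋(m•x)`. [ours; bookkeeping] -/
def Z (G : Fin 3 → Fin 3 → ℝ) (m : ℕ) (x : UnitAddTorus (Fin 3)) : Fin 3 → Fin 3 → ℝ :=
  G + D.slope x • D.M + D.EP x • D.XP (m • x) + D.EM x • D.XM (m • x)

/-- The full gradient `T(x) = G + ∇curl A(x)`. [ours; bookkeeping] -/
def T (G : Fin 3 → Fin 3 → ℝ) (m : ℕ) (x : UnitAddTorus (Fin 3)) : Fin 3 → Fin 3 → ℝ :=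
  G + gradAt (curlField (D.Atot m)) x

/-- The plateau bases `Y₊ = G + (1−μ)M`, `Y₋ = G − μM`. [ours; bookkeeping] -/
def Yp (G : Fin 3 → Fin 3 → ℝ) : Fin 3 → Fin 3 → ℝ := G + (1 - D.q.mu) • D.M

/-- The plateau base `Y₋ = G − μM`. [ours; bookkeeping] -/
def Ym (G : Fin 3 → Fin 3 → ℝ) : Fin 3 → Fin 3 → ℝ := G + (-D.q.mu) • D.M

/-- The child states `G₊ = G + (1−λ)M`, `G₋ = G − λM`. [ours; bookkeeping] -/
def Gp (G : Fin 3 → Fin 3 → ℝ) : Fin 3 → Fin 3 → ℝ := G + (1 - D.q.lam) • D.M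

/-- The child state `G₋ = G − λM`. [ours; bookkeeping] -/
def Gm (G : Fin 3 → Fin 3 → ℝ) : Fin 3 → Fin 3 → ℝ := G + (-D.q.lam) • D.M

section Estimates

variable {G : Fin 3 → Fin 3 → ℝ} {βG βM βX ρp ρm : ℝ} {m : ℕ}
variable (hβG : ∀ i j, |G i j| ≤ βG) (hβM : ∀ i j, |D.M i j| ≤ βM)
  (hβXp : ∀ y i j, |D.XP y i j| ≤ βX) (hβXm : ∀ y i j, |D.XM y i j| ≤ βX)
  (hRp : ∀ x i j, |gradAt (curlField (D.BP m)) x i j - D.EP x * D.XP (m • x) i j| ≤ ρp)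
  (hRm : ∀ x i j, |gradAt (curlField (D.BM m)) x i j - D.EM x * D.XM (m • x) i j| ≤ ρm)

/-- Entries of `T`. [ours; bookkeeping] -/
theorem T_apply (x : UnitAddTorus (Fin 3)) (i j : Fin 3) :
    D.T G m x i j = G i j + D.slope x * D.M i j + gradAt (curlField (D.BP m)) x i j + gradAt (curlField (D.BM m)) x i j := by
  simp only [T, Pi.add_apply, gradAt_curlField_Atot]; ring

/-- Entries of `Z`. [ours; bookkeeping] -/
theorem Z_apply (x : UnitAddTorus (Fin 3)) (i j : Fin 3) :
    D.Z G m x i j = G i j + D.slope x * D.M i j + D.EP x * D.XP (m • x) i j + D.EM x * D.XM (m • x) i j := by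
  simp only [Z, Pi.add_apply, Pi.smul_apply, smul_eq_mul]

include hRp hRm in
/-- **`|T − Z| ≤ ρ₊ + ρ₋` entrywise.** [ours] -/
theorem abs_T_sub_Z_le (x : UnitAddTorus (Fin 3)) (i j : Fin 3) : |D.T G m x i j - D.Z G m x i j| ≤ ρp + ρm := by
  rw [T_apply, Z_apply]
  calc _ = |(gradAt (curlField (D.BP m)) x i j - D.EP x * D.XP (m • x) i j) +
        (gradAt (curlField (D.BM m)) x i j - D.EM x * D.XM (m • x) i j)| := by ring_nf
    _ ≤ _ := (abs_add_le _ _).trans (add_le_add (hRp x i j) (hRm x i j))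

include hβG hβM hβXp hβXm in
/-- **`|Z| ≤ β_G + β_M + 2β_X` entrywise.** [ours] -/
theorem abs_Z_le (x : UnitAddTorus (Fin 3)) (i j : Fin 3) : |D.Z G m x i j| ≤ βG + βM + 2 * βX := by
  have hs := D.abs_slope_le x
  have hp := D.EP_mem x
  have hn := D.EM_mem x
  have hβM0 : 0 ≤ βM := (abs_nonneg _).trans (hβM 0 0)
  have hβX0 : 0 ≤ βX := (abs_nonneg _).trans (hβXp 0 0 0)
  rw [Z_apply]
  have t1 : |D.slope x * D.M i j| ≤ βM := by
    rw [abs_mul]; exact (mul_le_mul hs (hβM i j) (abs_nonneg _) zero_le_one).trans (by rw [one_mul])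
  have t2 : |D.EP x * D.XP (m • x) i j| ≤ βX := by
    rw [abs_mul, abs_of_nonneg hp.1]; exact (mul_le_mul hp.2 (hβXp _ i j) (abs_nonneg _) zero_le_one).trans (by rw [one_mul])
  have t3 : |D.EM x * D.XM (m • x) i j| ≤ βX := by
    rw [abs_mul, abs_of_nonneg hn.1]; exact (mul_le_mul hn.2 (hβXm _ i j) (abs_nonneg _) zero_le_one).trans (by rw [one_mul])
  calc _ ≤ |G i j + D.slope x * D.M i j + D.EP x * D.XP (m • x) i j| + |D.EM x * D.XM (m • x) i j| := abs_add_le _ _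
    _ ≤ (|G i j + D.slope x * D.M i j| + |D.EP x * D.XP (m • x) i j|) + |D.EM x * D.XM (m • x) i j| := by
        gcongr; exact abs_add_le _ _
    _ ≤ ((|G i j| + |D.slope x * D.M i j|) + |D.EP x * D.XP (m • x) i j|) + |D.EM x * D.XM (m • x) i j| := by
        gcongr; exact abs_add_le _ _
    _ ≤ ((βG + βM) + βX) + βX := by gcongr; exact hβG i j
    _ = βG + βM + 2 * βX := by ring

/-! ## 3. The ceiling -/

include hβG hβM hβXp hβXm hRp hRm in
/-- **THE VORTICITY CEILING of the laminate step.** If `|ω(G±)|² ≤ B±` and `|ω(G± + X±(y))|² ≤ B±` for all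
`y`, then for every `x`,
`|ω(G + ∇curl A(x))|² ≤ max B₊ B₋ + 24ρ′(β′ + ρ′)`, `ρ′ = 2εβ_M + ρ₊ + ρ₋`, `β′ = β_G + β_M + β_X`. [ours] -/
theorem vortSqM_T_le {Bp Bm : ℝ} (hGp : vortSqM (D.Gp G) ≤ Bp) (hGm : vortSqM (D.Gm G) ≤ Bm)
    (hVp : ∀ y, vortSqM (D.Gp G + D.XP y) ≤ Bp) (hVm : ∀ y, vortSqM (D.Gm G + D.XM y) ≤ Bm)
    (x : UnitAddTorus (Fin 3)) :
    vortSqM (D.T G m x) ≤ max Bp Bm +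
      24 * (2 * D.q.eps * βM + ρp + ρm) * ((βG + βM + βX) + (2 * D.q.eps * βM + ρp + ρm)) :=
  ceiling_core hGp hGm (hVp (m • x)) (hVm (m • x)) (D.EP_mem x) (D.EM_mem x) (D.slope_mem x)
    ⟨D.q.lam_pos, D.q.lam_lt_one⟩ D.q.abs_mu_sub_lam_le (fun h => D.EP_ne_zero h) (fun h => D.EM_ne_zero h)
    hβG hβM (hβXp (m • x)) (hβXm (m • x)) (hRp x) (hRm x) (D.T_apply x)

/-! ## 4. Densities of `T` versus `Z`, and the plateau expansions of `Z` -/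

include hβG hβM hβXp hβXm hRp hRm in
/-- `|prodBC(T) − prodBC(Z)| ≤ 162ρ(β_Z + ρ)²`, `ρ = ρ₊ + ρ₋`, `β_Z = β_G + β_M + 2β_X`. [ours] -/
theorem abs_prodBC_T_sub_le (x : UnitAddTorus (Fin 3)) :
    |prodBC (D.T G m x) - prodBC (D.Z G m x)| ≤ 162 * (ρp + ρm) * ((βG + βM + 2 * βX) + (ρp + ρm)) ^ 2 := by
  have h1 : |(1 : ℝ)| ≤ 1 := by rw [abs_one]
  have h := abs_prodBC_sub_le h1 (D.abs_Z_le hβG hβM hβXp hβXm x)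
    (Y := D.T G m x) (ρ := ρp + ρm) (fun i j => by rw [one_mul]; exact D.abs_T_sub_Z_le hRp hRm x i j)
  simpa only [one_pow, one_mul] using h

include hβG hβM hβXp hβXm hRp hRm in
/-- `|halfSqM(T) − halfSqM(Z)| ≤ 9ρ(β_Z + ρ)`. [ours] -/
theorem abs_halfSqM_T_sub_le (x : UnitAddTorus (Fin 3)) :
    |halfSqM (D.T G m x) - halfSqM (D.Z G m x)| ≤ 9 * (ρp + ρm) * ((βG + βM + 2 * βX) + (ρp + ρm)) :=
  abs_halfSqM_sub_le (D.abs_Z_le hβG hβM hβXp hβXm x) (fun i j => D.abs_T_sub_Z_le hRp hRm x i j)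

/-- **Plateau expansion of `prodBC(Z)`.** [ours] -/
theorem prodBC_Z_eq (x : UnitAddTorus (Fin 3)) :
    prodBC (D.Z G m x) = prodBC (G + D.slope x • D.M) +
      (D.EP x * mix₁ (D.Yp G) (D.XP (m • x)) + D.EP x ^ 2 * mix₂ (D.Yp G) (D.XP (m • x)) +
        D.EP x ^ 3 * prodBC (D.XP (m • x))) +
      (D.EM x * mix₁ (D.Ym G) (D.XM (m • x)) + D.EM x ^ 2 * mix₂ (D.Ym G) (D.XM (m • x)) +
        D.EM x ^ 3 * prodBC (D.XM (m • x))) :=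
  prodBC_expand_core (fun h => D.EP_ne_zero h) (fun h => D.EM_ne_zero h)

/-- **Plateau expansion of `halfSqM(Z)`.** [ours] -/
theorem halfSqM_Z_eq (x : UnitAddTorus (Fin 3)) :
    halfSqM (D.Z G m x) = halfSqM (G + D.slope x • D.M) +
      (D.EP x * frob (D.Yp G) (D.XP (m • x)) + D.EP x ^ 2 * halfSqM (D.XP (m • x))) +
      (D.EM x * frob (D.Ym G) (D.XM (m • x)) + D.EM x ^ 2 * halfSqM (D.XM (m • x))) :=
  halfSqM_expand_core (fun h => D.EP_ne_zero h) (fun h => D.EM_ne_zero h)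

end Estimates

/-! ## 5. Continuity bookkeeping for the integrands -/

/-- Entries of `T` are continuous. [folklore] -/
theorem continuous_T_apply (G : Fin 3 → Fin 3 → ℝ) (m : ℕ) (i j : Fin 3) : Continuous fun x => D.T G m x i j := by
  simp only [T, Pi.add_apply]
  exact continuous_const.add (continuous_gradAt (isSmooth_curlField (D.isSmooth_Atot m)) i j)

/-- Entries of `Z` are continuous. [folklore] -/
theorem continuous_Z_apply (G : Fin 3 → Fin 3 → ℝ) (m : ℕ) (i j : Fin 3) : Continuous fun x => D.Z G m x i j := by
  simp only [Z_apply]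
  have hs := D.continuous_slope
  have hp := (D.isSmooth_EP).continuous
  have hn := (D.isSmooth_EM).continuous
  have hXp : Continuous fun x => D.XP (m • x) i j := (continuous_gradAt (isSmooth_curlField D.hAp) i j).comp (continuous_nsmul m)
  have hXm : Continuous fun x => D.XM (m • x) i j := (continuous_gradAt (isSmooth_curlField D.hAm) i j).comp (continuous_nsmul m)
  unfold EP EM LamParam.envP LamParam.envM at *
  fun_prop

/-- Entries of the laminate part `G + φ(k·x)M` are continuous. [folklore] -/
theorem continuous_lam_apply (G : Fin 3 → Fin 3 → ℝ) (i j : Fin 3) :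
    Continuous fun x => (G + D.slope x • D.M) i j := by
  simp only [Pi.add_apply, Pi.smul_apply, smul_eq_mul]
  exact continuous_const.add (D.continuous_slope.mul continuous_const)

end LamData

end Summit.NavierStokesRegularity.FunctionalMining

end
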